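import Mathlib
import Literature.Computability.AlgebraicComplexity.FSV18OccurTopFanIn
import HarnessLib

/-!
# [ASSS16] §4: the recursion `r_{ℓ+1} = (c_ℓ+1)·2^{c_ℓ+1}·k·r_ℓ²` stays below `R = (2k)^{2D·2^D}`
# — proofs only (N1 occur push, plan step F4, numeric glue F1 → Cor. 49)

M. Agrawal, C. Saha, R. Saptharishi, N. Saxena, arXiv:1111.0582 [AgrawalEtAl2011], §4, proof of
Theorem `thm:dDkrPIT` (p0010:L40–L43): "Using the relation between `r_{ℓ+1}` and `r_ℓ` from Lemma
(lem:descent-jacobian), it is easy to bound `r_{D-2}` by `R = (2k)^{2D·2^D}`." The recursion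
(Lemma 4.2, p0010:L16–L19): `r_{ℓ+1} := (c_ℓ+1)·2^{c_ℓ+1}·k·r_ℓ²`, `c_{ℓ+1} := c_ℓ + 1`, from
`r_2 ≤ k`, `c_2 = 0` (p0010:L9–L10). In the tree: `asssRec k t j = (r_{2+j}, c_{2+j})` started at
`r_2 = t` (`FSV18OccurTopFanIn.lean`, val-lit p1), and FSV's `asssR k D = (2k)^{2D·2^D}`
(`FSV18SuccinctGenerators.lean`). This file proves the printed "easy to bound": for `t ≤ k` and
`D ≥ 1`, `r_{D-2} ≤ asssR k D`, and without any hypothesis on `t`, `r_{2+j} ≤ asssR (max k t) D`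
for every `j ≤ D - 4` — the numeric glue by which the block sizes `r_ℓ` of the level recursion
fit the `R = (2·max(k,t))^{2D·2^D}` seeds of the as-printed statement `FSV2018_thm48_topFanIn`.

* `ASSS16.asssRec_snd` — `c_{2+j} = j`;
* `ASSS16.asssRec_fst_le` — `r_{2+j} ≤ (2k)^{2^{j+3} - 2j - 4}` for `1 ≤ k`, `t ≤ k` (invariant:
  `(j+1)·2^{j+1}·k ≤ (2k)^{2j+2}`); `ASSS16.asssRec_fst_eq_zero` — `k = 0 ⇒ r = 0`;
* `ASSS16.asssRec_fst_le_asssR` — `t ≤ k`, `1 ≤ D ⇒ r_{D-2} ≤ asssR k D`; `asssRec_fst_mono`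
  (monotone in `k`, `t`), `asssRec_fst_mono_level` (in the level, `k ≥ 1`),
  `asssRec_fst_le_asssR_max(_of_le)` — `r_{2+j} ≤ asssR (max k t) D` for every `j ≤ D - 4`, no
  hypothesis on `t` vs `k` (all statements on `asssRec` itself, independent of how the cell's
  abbreviation `asssRTop` is defined — val-lit p1 g3 is re-defining it as the printed closed form,
  proposal p460242);
* `ASSS16.two_mul_mul_asssRec_le_asssR`, `ASSS16.level_char_budget`, `ASSS16.char_clause_of_level`
  — the printed characteristic clause `s^R < char` (`R = (2·max(k,t))^{2D·2^D}`) covers the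
  Jacobian criterion's `d^r < char` at every level (`d ≤ (s+1)^D`, `r ≤ r_{2+j}`, `s ≥ 2`);
* `…_of_le_sub_three` variants (`asssRec_fst_le_asssR_max_of_le_sub_three`,
  `two_mul_mul_asssRec_le_asssR_of_le_sub_three`, `level_char_budget_of_le_sub_three`,
  `char_clause_of_level_sub_three`, `sparsity_budget_of_le_sub_three`) — the same up to level index
  `j ≤ D - 3` (the FSV model's leaf-derivative level, val-lit t18 g3's F4 pre-flight).

No definitions, no named facts. Honest framing: arithmetic bookkeeping; nothing here bears on
`VP ≠ VNP`.

## References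
* [AgrawalEtAl2011] arXiv:1111.0582 §4, Lemma 4.2 and proof of Thm. dDkrPIT (locator:
  paper:arxiv-1111.0582 p0010.txt:L9–L19, L40–L43).
-/

namespace Literature.Computability.AlgebraicComplexity

namespace ASSS16

/-- `c_{2+j} = j` ("`c_{ℓ+1} := c_ℓ + 1`", `c_2 = 0`). [cite: AgrawalEtAl2011, Lemma 4.2 (= lem:descent-jacobian)]
locator: paper:arxiv-1111.0582 p0010.txt:L9–L19 -/
theorem asssRec_snd (k t : ℕ) : ∀ j : ℕ, (asssRec k t j).2 = j
  | 0 => rfl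
  | j + 1 => by rw [asssRec, asssRec_snd k t j]

/-- The recursion unfolded with `c_{2+j} = j`: `r_{2+j+1} = (j+1)·2^{j+1}·k·r_{2+j}²`.
[cite: AgrawalEtAl2011, Lemma 4.2 (= lem:descent-jacobian)] locator: paper:arxiv-1111.0582 p0010.txt:L16–L19 -/
theorem asssRec_fst_succ (k t j : ℕ) :
    (asssRec k t (j + 1)).1 = (j + 1) * 2 ^ (j + 1) * k * (asssRec k t j).1 ^ 2 := by
  rw [asssRec, asssRec_snd k t j]

/-- For `k = 0` (no gates depend on anything) the whole sequence vanishes from `r_2 = t ≤ 0`.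
[cite: AgrawalEtAl2011, §4 (Thm. dDkrPIT, proof)] locator: paper:arxiv-1111.0582 p0010.txt:L40–L43 -/
theorem asssRec_fst_eq_zero (t : ℕ) (ht : t = 0) : ∀ j : ℕ, (asssRec 0 t j).1 = 0
  | 0 => ht
  | j + 1 => by rw [asssRec_fst_succ, mul_zero, zero_mul]

/-- The elementary step of the "easy" bound: `(j+1)·2^{j+1}·k ≤ (2k)^{2j+2}` for `k ≥ 1`.
[cite: AgrawalEtAl2011, §4 (Thm. dDkrPIT, proof: "it is easy to bound `r_{D-2}`")] locator: paper:arxiv-1111.0582 p0010.txt:L40–L43 -/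
theorem succ_mul_two_pow_mul_le (k j : ℕ) :
    (j + 1) * 2 ^ (j + 1) * k ≤ (2 * k) ^ (2 * j + 2) := by
  have hj : j + 1 ≤ 2 ^ (j + 1) := Nat.lt_two_pow_self.le
  have hk' : k ≤ k ^ (2 * j + 2) := Nat.le_self_pow (by omega) k
  calc (j + 1) * 2 ^ (j + 1) * k ≤ 2 ^ (j + 1) * 2 ^ (j + 1) * k ^ (2 * j + 2) :=
        Nat.mul_le_mul (Nat.mul_le_mul_right _ hj) hk'
    _ = (2 * k) ^ (2 * j + 2) := by
        rw [mul_pow, ← pow_add, show j + 1 + (j + 1) = 2 * j + 2 by ring]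

/-- **The invariant:** for `1 ≤ k` and `r_2 = t ≤ k`, `r_{2+j} ≤ (2k)^{2^{j+3} - 2j - 4}`
(exponents `4, 10, 24, 54, …`; the step uses `succ_mul_two_pow_mul_le` and
`2(2^{j+3} - 2j - 4) + (2j + 2) = 2^{j+4} - 2(j+1) - 4`).
[cite: AgrawalEtAl2011, §4 (Thm. dDkrPIT, proof: "it is easy to bound `r_{D-2}` by `R = (2k)^{2D·2^D}`")]
locator: paper:arxiv-1111.0582 p0010.txt:L40–L43 -/
theorem asssRec_fst_le {k t : ℕ} (hk : 1 ≤ k) (ht : t ≤ k) :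
    ∀ j : ℕ, (asssRec k t j).1 ≤ (2 * k) ^ (2 ^ (j + 3) - 2 * j - 4)
  | 0 => by
    show t ≤ (2 * k) ^ (2 ^ 3 - 2 * 0 - 4)
    norm_num
    calc t ≤ k := ht
      _ ≤ 2 * k := Nat.le_mul_of_pos_left k two_pos
      _ ≤ (2 * k) ^ 4 := Nat.le_self_pow (by norm_num) _
  | j + 1 => by
    rw [asssRec_fst_succ]
    have ih := asssRec_fst_le hk ht j
    have h2k : 1 ≤ 2 * k := by omega
    have hpow : 2 ^ (j + 4) = 2 * 2 ^ (j + 3) := by rw [pow_succ, mul_comm]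
    have hbig : 2 * j + 4 ≤ 2 ^ (j + 3) := by
      have := @Nat.lt_two_pow_self j
      have h8 : 2 ^ (j + 3) = 8 * 2 ^ j := by rw [pow_add]; ring
      omega
    have hexp : (2 * j + 2) + 2 * (2 ^ (j + 3) - 2 * j - 4) = 2 ^ (j + 1 + 3) - 2 * (j + 1) - 4 := by
      rw [show j + 1 + 3 = j + 4 by ring, hpow]
      omega
    calc (j + 1) * 2 ^ (j + 1) * k * (asssRec k t j).1 ^ 2
        ≤ (2 * k) ^ (2 * j + 2) * ((2 * k) ^ (2 ^ (j + 3) - 2 * j - 4)) ^ 2 :=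
          Nat.mul_le_mul (succ_mul_two_pow_mul_le k j) (Nat.pow_le_pow_left ih 2)
      _ = (2 * k) ^ (2 ^ (j + 1 + 3) - 2 * (j + 1) - 4) := by
          rw [← pow_mul, ← pow_add, ← hexp, mul_comm (2 ^ (j + 3) - 2 * j - 4) 2]

/-- The recursion is monotone in `k` and in the start value `t`.
[cite: AgrawalEtAl2011, Lemma 4.2 (= lem:descent-jacobian), the recursion] locator: paper:arxiv-1111.0582 p0010.txt:L16–L19 -/
theorem asssRec_fst_mono {k k' t t' : ℕ} (hk : k ≤ k') (ht : t ≤ t') :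
    ∀ j : ℕ, (asssRec k t j).1 ≤ (asssRec k' t' j).1
  | 0 => ht
  | j + 1 => by
    rw [asssRec_fst_succ, asssRec_fst_succ]
    exact Nat.mul_le_mul (Nat.mul_le_mul_left _ hk) (Nat.pow_le_pow_left (asssRec_fst_mono hk ht j) 2)

/-- The exponent bookkeeping: `2^{(D-4)+3} - 2(D-4) - 4 ≤ 2D·2^D` for `D ≥ 1`. [folklore] -/
private theorem exponent_le (D : ℕ) (hD : 1 ≤ D) :
    2 ^ (D - 4 + 3) - 2 * (D - 4) - 4 ≤ 2 * D * 2 ^ D := by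
  rcases Nat.lt_or_ge D 4 with hD4 | hD4
  · interval_cases D <;> norm_num
  · have h1 : 2 ^ (D - 4 + 3) - 2 * (D - 4) - 4 ≤ 2 ^ (D - 4 + 3) :=
      (Nat.sub_le _ _).trans (Nat.sub_le _ _)
    have h2 : 2 ^ (D - 4 + 3) ≤ 2 ^ D := Nat.pow_le_pow_right (by norm_num) (by omega)
    have h3 : 2 ^ D ≤ 2 * D * 2 ^ D := Nat.le_mul_of_pos_left _ (by omega)
    exact h1.trans (h2.trans h3)

/-- **"It is easy to bound `r_{D-2}` by `R = (2k)^{2D·2^D}`":** for `t ≤ k` and `D ≥ 1`, the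
recursion value `r_{D-2} = (asssRec k t (D-4)).1` is at most FSV's `asssR k D = (2k)^{2D·2^D}`.
(Stated on `asssRec` directly, independent of how the cell's `asssRTop` abbreviation is defined;
for `D = 0` the claim fails: `asssR k 0 = 1` while `r = t`.)
[cite: AgrawalEtAl2011, §4 (Thm. dDkrPIT, proof); ForbesShpilkaVolk2018, Construction 46 (seq.) = ToC Construction 5.22 (`R = (2k)^{2D·2^D}`)]
locator: paper:arxiv-1111.0582 p0010.txt:L40–L43; paper:arxiv-1701.05328 p0021.txt:L11 -/
theorem asssRec_fst_le_asssR {k D t : ℕ} (ht : t ≤ k) (hD : 1 ≤ D) :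
    (asssRec k t (D - 4)).1 ≤ asssR k D := by
  unfold asssR
  rcases Nat.eq_zero_or_pos k with rfl | hk
  · rw [asssRec_fst_eq_zero t (Nat.le_zero.mp ht)]
    exact Nat.zero_le _
  · exact (asssRec_fst_le hk ht (D - 4)).trans (Nat.pow_le_pow_right (by omega) (exponent_le D hD))

/-- The same bound against the print's normalisation `t = k` read as `max k t` (no hypothesis
relating `t` and `k`): `r_{D-2}(k, t) ≤ (2·max(k,t))^{2D·2^D} = asssR (max k t) D` — the form in
which the block sizes `r_ℓ ≤ R` of the as-printed statement are checked when `R` is the printed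
closed form. [cite: AgrawalEtAl2011, §4 (Thm. dDkrPIT, proof: "it is easy to bound `r_{D-2}` by `R`")]
locator: paper:arxiv-1111.0582 p0010.txt:L40–L43 -/
theorem asssRec_fst_le_asssR_max {k D t : ℕ} (hD : 1 ≤ D) :
    (asssRec k t (D - 4)).1 ≤ asssR (max k t) D :=
  (asssRec_fst_mono (le_max_left k t) (le_max_right k t) (D - 4)).trans
    (asssRec_fst_le_asssR le_rfl hD)

/-- For `k ≥ 1` the recursion is non-decreasing in the level index.
[cite: AgrawalEtAl2011, Lemma 4.2 (= lem:descent-jacobian), the recursion] locator: paper:arxiv-1111.0582 p0010.txt:L16–L19 -/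
theorem asssRec_fst_le_succ {k : ℕ} (hk : 1 ≤ k) (t j : ℕ) :
    (asssRec k t j).1 ≤ (asssRec k t (j + 1)).1 := by
  rw [asssRec_fst_succ]
  rcases Nat.eq_zero_or_pos ((asssRec k t j).1) with h0 | hpos
  · rw [h0]; exact Nat.zero_le _
  · calc (asssRec k t j).1 = 1 * 1 * 1 * (asssRec k t j).1 ^ 1 := by ring
      _ ≤ (j + 1) * 2 ^ (j + 1) * k * (asssRec k t j).1 ^ 2 :=
        Nat.mul_le_mul (Nat.mul_le_mul (Nat.mul_le_mul (by omega) Nat.one_le_two_pow) hk)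
          (Nat.pow_le_pow_right hpos (by norm_num))

/-- … hence monotone: `r_{2+j} ≤ r_{2+j'}` for `j ≤ j'`, `k ≥ 1`.
[cite: AgrawalEtAl2011, Lemma 4.2 (= lem:descent-jacobian), the recursion] locator: paper:arxiv-1111.0582 p0010.txt:L16–L19 -/
theorem asssRec_fst_mono_level {k : ℕ} (hk : 1 ≤ k) (t : ℕ) {j j' : ℕ} (hj : j ≤ j') :
    (asssRec k t j).1 ≤ (asssRec k t j').1 := by
  obtain ⟨m, rfl⟩ := Nat.exists_eq_add_of_le hj
  clear hj
  induction m with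
  | zero => exact le_rfl
  | succ m ih => exact ih.trans (by rw [← add_assoc]; exact asssRec_fst_le_succ hk t (j + m))

/-- **Every block fits the `R` seeds:** `r_{2+j} ≤ (2·max(k,t))^{2D·2^D} = asssR (max k t) D` for
all `j ≤ D - 4`, `D ≥ 1` (for `k = 0` the values are `t, 0, 0, …`).
[cite: AgrawalEtAl2011, §4 (Thm. dDkrPIT, proof) with Lemma 4.2] locator: paper:arxiv-1111.0582 p0010.txt:L16–L19, L40–L43 -/
theorem asssRec_fst_le_asssR_max_of_le {k D t j : ℕ} (hD : 1 ≤ D) (hj : j ≤ D - 4) :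
    (asssRec k t j).1 ≤ asssR (max k t) D := by
  rcases Nat.eq_zero_or_pos k with rfl | hk
  · -- `k = 0`: `r_0 = t ≤ (2t)^{2D·2^D}`, later values vanish
    cases j with
    | zero =>
      show t ≤ asssR (max 0 t) D
      rw [Nat.zero_max]
      unfold asssR
      rcases Nat.eq_zero_or_pos t with rfl | ht
      · exact Nat.zero_le _
      · exact (Nat.le_mul_of_pos_left t two_pos).trans
          (Nat.le_self_pow (by positivity) _)
    | succ n => rw [asssRec_fst_succ, mul_zero, zero_mul]; exact Nat.zero_le _
  · exact (asssRec_fst_mono_level hk t hj).trans (asssRec_fst_le_asssR_max hD)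

/-! ### The characteristic budget at every level ("For the Jacobian criterion to work we need
### `char(𝔽) = 0` or `> s^R`", p0010:L74–L75) -/

/-- `2D · r_{2+j} ≤ R = (2K)^{2D·2^D}` (`K = max(k,t)`, `j ≤ D - 4`, `D ≥ 1`): the block sizes times
the depth still fit under the printed closed form. [cite: AgrawalEtAl2011, §4 (Thm. dDkrPIT, proof: "it is easy to bound `r_{D-2}` by `R`"; "we need char `= 0` or `> s^R`")]
locator: paper:arxiv-1111.0582 p0010.txt:L40–L43, L74–L75 -/
theorem two_mul_mul_asssRec_le_asssR {k D t j : ℕ} (hD : 1 ≤ D) (hj : j ≤ D - 4) :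
    2 * D * (asssRec k t j).1 ≤ asssR (max k t) D := by
  unfold asssR
  set K := max k t with hK
  rcases Nat.eq_zero_or_pos K with hK0 | hKpos
  · -- `k = t = 0`: all values vanish
    have hk0 : k = 0 := Nat.eq_zero_of_le_zero (hK0 ▸ le_max_left k t)
    have ht0 : t = 0 := Nat.eq_zero_of_le_zero (hK0 ▸ le_max_right k t)
    subst hk0; subst ht0
    rw [asssRec_fst_eq_zero 0 rfl j, mul_zero]
    exact Nat.zero_le _
  · have h2 : 2 * D ≤ (2 * K) ^ D :=
      calc 2 * D ≤ 2 ^ D := by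
            rcases Nat.lt_or_ge D 2 with hD2 | hD2
            · interval_cases D; norm_num
            · have h4 : 2 ^ D = 2 * 2 ^ (D - 1) := by
                rw [← pow_succ']; congr 1; omega
              have := @Nat.lt_two_pow_self (D - 1)
              omega
        _ ≤ (2 * K) ^ D := Nat.pow_le_pow_left (by omega) D
    have h2K : 1 ≤ 2 * K := by omega
    cases j with
    | zero =>
      -- `r_2 = t ≤ K`: `2D·t ≤ (2K)^D · (2K) = (2K)^{D+1} ≤ (2K)^{2D·2^D}`
      show 2 * D * t ≤ (2 * K) ^ (2 * D * 2 ^ D)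
      have hD1 : D + 1 ≤ 2 * D * 2 ^ D := by
        have : D < 2 ^ D := Nat.lt_two_pow_self
        nlinarith
      calc 2 * D * t ≤ (2 * K) ^ D * (2 * K) :=
            Nat.mul_le_mul h2 ((le_max_right k t).trans (Nat.le_mul_of_pos_left K two_pos))
        _ = (2 * K) ^ (D + 1) := (pow_succ _ _).symm
        _ ≤ (2 * K) ^ (2 * D * 2 ^ D) := Nat.pow_le_pow_right h2K hD1
    | succ n =>
      -- `j = n + 1 ≥ 1` forces `D ≥ 5`; `r_{2+j} ≤ (2K)^{2^{j+3}} ≤ (2K)^{2^{D-1}}`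
      have hD5 : n + 1 + 3 ≤ D - 1 := by omega
      have h1 : (asssRec k t (n + 1)).1 ≤ (2 * K) ^ 2 ^ (D - 1) :=
        calc (asssRec k t (n + 1)).1 ≤ (asssRec K K (n + 1)).1 :=
              asssRec_fst_mono (le_max_left k t) (le_max_right k t) (n + 1)
          _ ≤ (2 * K) ^ (2 ^ (n + 1 + 3) - 2 * (n + 1) - 4) := asssRec_fst_le hKpos le_rfl (n + 1)
          _ ≤ (2 * K) ^ 2 ^ (D - 1) := Nat.pow_le_pow_right h2K
              ((Nat.sub_le _ _).trans ((Nat.sub_le _ _).trans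
                (Nat.pow_le_pow_right (by norm_num) hD5)))
      have h3 : D + 2 ^ (D - 1) ≤ 2 * D * 2 ^ D := by
        have h4 : 2 ^ D = 2 * 2 ^ (D - 1) := by rw [← pow_succ']; congr 1; omega
        have h5 : 1 ≤ 2 ^ (D - 1) := Nat.one_le_two_pow
        rw [h4]
        nlinarith
      calc 2 * D * (asssRec k t (n + 1)).1 ≤ (2 * K) ^ D * (2 * K) ^ 2 ^ (D - 1) :=
            Nat.mul_le_mul h2 h1
        _ = (2 * K) ^ (D + 2 ^ (D - 1)) := (pow_add _ _ _).symm
        _ ≤ (2 * K) ^ (2 * D * 2 ^ D) := Nat.pow_le_pow_right h2K h3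

/-- **The characteristic budget of the printed clause covers every level:** with the degree bound
`(s+1)^D` of depth-`D` size-`s` formulas (FSV size convention, `OccurFormula.totalDegree_eval_le`)
and at most `r_{2+j}` polynomials in a level family, the Jacobian criterion's requirement
`d^r < char` follows from the printed `s^R < char`, `R = (2·max(k,t))^{2D·2^D}`, for `s ≥ 2`
(`s ≤ 1`: constants only): `((s+1)^D)^{r_{2+j}} ≤ s^R`.
[cite: AgrawalEtAl2011, §4 (Thm. dDkrPIT: "assuming char(𝔽) = 0 or > s^R"), Fact 1 / Lemma 2.2 ("char > d^r")]
locator: paper:arxiv-1111.0582 p0005.txt:L17–L20; p0006.txt:L19–L24; p0010.txt:L74–L75 -/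
theorem level_char_budget {s k D t j : ℕ} (hs : 2 ≤ s) (hD : 1 ≤ D) (hj : j ≤ D - 4) :
    ((s + 1) ^ D) ^ (asssRec k t j).1 ≤ s ^ asssR (max k t) D := by
  have hs1 : s + 1 ≤ s ^ 2 := by nlinarith
  calc ((s + 1) ^ D) ^ (asssRec k t j).1 ≤ ((s ^ 2) ^ D) ^ (asssRec k t j).1 :=
        Nat.pow_le_pow_left (Nat.pow_le_pow_left hs1 D) _
    _ = s ^ (2 * D * (asssRec k t j).1) := by rw [← pow_mul, ← pow_mul, Nat.mul_assoc]
    _ ≤ s ^ asssR (max k t) D :=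
        Nat.pow_le_pow_right (by omega) (two_mul_mul_asssRec_le_asssR hD hj)

/-- … in the form the Jacobian criterion consumes: `char = 0 ∨ s^R < char` gives `char = 0 ∨ d^r <
char` for any `d ≤ (s+1)^D`, `r ≤ r_{2+j}`. [cite: AgrawalEtAl2011, §4 (Thm. dDkrPIT) with Fact 1 / Lemma 2.2]
locator: paper:arxiv-1111.0582 p0010.txt:L74–L75 -/
theorem char_clause_of_level {F : Type*} [Field F] {s k D t j d r : ℕ} (hs : 2 ≤ s) (hD : 1 ≤ D)
    (hj : j ≤ D - 4) (hd : d ≤ (s + 1) ^ D) (hr : r ≤ (asssRec k t j).1)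
    (hchar : ringChar F = 0 ∨ s ^ asssR (max k t) D < ringChar F) :
    ringChar F = 0 ∨ d ^ r < ringChar F := by
  refine hchar.imp id fun h => lt_of_le_of_lt ?_ h
  calc d ^ r ≤ ((s + 1) ^ D) ^ r := Nat.pow_le_pow_left hd r
    _ ≤ ((s + 1) ^ D) ^ (asssRec k t j).1 := Nat.pow_le_pow_right (by positivity) hr
    _ ≤ s ^ asssR (max k t) D := level_char_budget hs hD hj

/-! ### One more level (`j ≤ D - 3`): the leaf-derivative families of the FSV model
(val-lit t18 g3, F4 pre-flight 2026-08-26: in the tree's `OccurFormula` model the recursion from the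
top `+` gate to the leaf-derivative sets takes up to `D - 3` steps, one more than the printed
`D - 4`; the closed form still dominates). -/

/-- `r_{2+j} ≤ (2K)^{2^{j+3} - 2j - 4}` with `K = max(k,t) ≥ 1`, for EVERY `j`.
[cite: AgrawalEtAl2011, §4 (Thm. dDkrPIT, proof) with Lemma 4.2] locator: paper:arxiv-1111.0582 p0010.txt:L16–L19, L40–L43 -/
theorem asssRec_fst_le_pow_max {k t : ℕ} (hK : 1 ≤ max k t) (j : ℕ) :
    (asssRec k t j).1 ≤ (2 * max k t) ^ (2 ^ (j + 3) - 2 * j - 4) :=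
  (asssRec_fst_mono (le_max_left k t) (le_max_right k t) j).trans (asssRec_fst_le hK le_rfl j)

/-- **Blocks fit the seeds, up to level index `D - 3`:** `r_{2+j} ≤ asssR (max k t) D` for
`j ≤ D - 3`, `D ≥ 1`. [cite: AgrawalEtAl2011, §4 (Thm. dDkrPIT, proof: "easy to bound `r_{D-2}` by `R`")]
locator: paper:arxiv-1111.0582 p0010.txt:L40–L43 -/
theorem asssRec_fst_le_asssR_max_of_le_sub_three {k D t j : ℕ} (hD : 1 ≤ D) (hj : j ≤ D - 3) :
    (asssRec k t j).1 ≤ asssR (max k t) D := by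
  unfold asssR
  rcases Nat.eq_zero_or_pos (max k t) with hK0 | hKpos
  · have hk0 : k = 0 := Nat.eq_zero_of_le_zero (hK0 ▸ le_max_left k t)
    have ht0 : t = 0 := Nat.eq_zero_of_le_zero (hK0 ▸ le_max_right k t)
    subst hk0; subst ht0
    rw [asssRec_fst_eq_zero 0 rfl j]
    exact Nat.zero_le _
  · refine (asssRec_fst_le_pow_max hKpos j).trans (Nat.pow_le_pow_right (by omega) ?_)
    -- `2^{j+3} - 2j - 4 ≤ 2^{j+3} ≤ 2^D ≤ 2D·2^D` (for `D ≥ 3`; small `D` forces `j = 0`, exponent 4)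
    rcases Nat.lt_or_ge D 3 with hD3 | hD3
    · interval_cases D <;> simp_all
    · calc 2 ^ (j + 3) - 2 * j - 4 ≤ 2 ^ (j + 3) := (Nat.sub_le _ _).trans (Nat.sub_le _ _)
        _ ≤ 2 ^ D := Nat.pow_le_pow_right (by norm_num) (by omega)
        _ ≤ 2 * D * 2 ^ D := Nat.le_mul_of_pos_left _ (by omega)

/-- `2D · r_{2+j} ≤ asssR (max k t) D` up to `j ≤ D - 3`. [cite: AgrawalEtAl2011, §4 (Thm. dDkrPIT, proof; "we need char `= 0` or `> s^R`")]
locator: paper:arxiv-1111.0582 p0010.txt:L40–L43, L74–L75 -/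
theorem two_mul_mul_asssRec_le_asssR_of_le_sub_three {k D t j : ℕ} (hD : 1 ≤ D)
    (hj : j ≤ D - 3) : 2 * D * (asssRec k t j).1 ≤ asssR (max k t) D := by
  cases j with
  | zero => exact two_mul_mul_asssRec_le_asssR hD (Nat.zero_le _)
  | succ n =>
    -- here `D ≥ 4`
    unfold asssR
    set K := max k t with hK
    rcases Nat.eq_zero_or_pos K with hK0 | hKpos
    · have hk0 : k = 0 := Nat.eq_zero_of_le_zero (hK0 ▸ le_max_left k t)
      have ht0 : t = 0 := Nat.eq_zero_of_le_zero (hK0 ▸ le_max_right k t)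
      subst hk0; subst ht0
      rw [asssRec_fst_eq_zero 0 rfl (n + 1), mul_zero]
      exact Nat.zero_le _
    · have h2K : 1 ≤ 2 * K := by omega
      have hD4 : 4 ≤ D := by omega
      have h2 : 2 * D ≤ (2 * K) ^ D :=
        calc 2 * D ≤ 2 ^ D := by
              have h4 : 2 ^ D = 2 * 2 ^ (D - 1) := by
                rw [← pow_succ']; congr 1; omega
              have := @Nat.lt_two_pow_self (D - 1)
              omega
          _ ≤ (2 * K) ^ D := Nat.pow_le_pow_left (by omega) D
      have h1 : (asssRec k t (n + 1)).1 ≤ (2 * K) ^ (2 ^ (n + 1 + 3) - 2 * (n + 1) - 4) :=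
        asssRec_fst_le_pow_max hKpos (n + 1)
      have h3 : D + (2 ^ (n + 1 + 3) - 2 * (n + 1) - 4) ≤ 2 * D * 2 ^ D := by
        have h5 : 2 ^ (n + 1 + 3) ≤ 2 ^ D := Nat.pow_le_pow_right (by norm_num) (by omega)
        have h6 : 2 ^ (n + 1 + 3) - 2 * (n + 1) - 4 ≤ 2 ^ D :=
          ((Nat.sub_le _ _).trans (Nat.sub_le _ _)).trans h5
        have h7 : D < 2 ^ D := Nat.lt_two_pow_self
        nlinarith
      calc 2 * D * (asssRec k t (n + 1)).1
          ≤ (2 * K) ^ D * (2 * K) ^ (2 ^ (n + 1 + 3) - 2 * (n + 1) - 4) := Nat.mul_le_mul h2 h1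
        _ = (2 * K) ^ (D + (2 ^ (n + 1 + 3) - 2 * (n + 1) - 4)) := (pow_add _ _ _).symm
        _ ≤ (2 * K) ^ (2 * D * 2 ^ D) := Nat.pow_le_pow_right h2K h3

/-- **Characteristic budget up to `j ≤ D - 3`**, spelled both as `((s+1)^D)^r` and `(s+1)^{D·r}`:
`(s+1)^{D · r_{2+j}} ≤ s^{asssR (max k t) D}` for `s ≥ 2`, `D ≥ 1`.
[cite: AgrawalEtAl2011, §4 (Thm. dDkrPIT: "assuming char(𝔽) = 0 or > s^R") with Fact 1 / Lemma 2.2 ("char > d^r")]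
locator: paper:arxiv-1111.0582 p0005.txt:L17–L20; p0006.txt:L19–L24; p0010.txt:L74–L75 -/
theorem level_char_budget_of_le_sub_three {s k D t j : ℕ} (hs : 2 ≤ s) (hD : 1 ≤ D)
    (hj : j ≤ D - 3) : (s + 1) ^ (D * (asssRec k t j).1) ≤ s ^ asssR (max k t) D := by
  have hs1 : s + 1 ≤ s ^ 2 := by nlinarith
  calc (s + 1) ^ (D * (asssRec k t j).1) ≤ (s ^ 2) ^ (D * (asssRec k t j).1) :=
        Nat.pow_le_pow_left hs1 _
    _ = s ^ (2 * D * (asssRec k t j).1) := by rw [← pow_mul, Nat.mul_assoc]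
    _ ≤ s ^ asssR (max k t) D :=
        Nat.pow_le_pow_right (by omega) (two_mul_mul_asssRec_le_asssR_of_le_sub_three hD hj)

/-- … consumable form: `char = 0 ∨ s^R < char ⇒ char = 0 ∨ d^r < char` for `d ≤ (s+1)^D`,
`r ≤ r_{2+j}`, `j ≤ D - 3`, `s ≥ 2`. [cite: AgrawalEtAl2011, §4 (Thm. dDkrPIT) with Fact 1 / Lemma 2.2]
locator: paper:arxiv-1111.0582 p0010.txt:L74–L75 -/
theorem char_clause_of_level_sub_three {F : Type*} [Field F] {s k D t j d r : ℕ} (hs : 2 ≤ s)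
    (hD : 1 ≤ D) (hj : j ≤ D - 3) (hd : d ≤ (s + 1) ^ D) (hr : r ≤ (asssRec k t j).1)
    (hchar : ringChar F = 0 ∨ s ^ asssR (max k t) D < ringChar F) :
    ringChar F = 0 ∨ d ^ r < ringChar F := by
  refine hchar.imp id fun h => lt_of_le_of_lt ?_ h
  calc d ^ r ≤ ((s + 1) ^ D) ^ r := Nat.pow_le_pow_left hd r
    _ ≤ ((s + 1) ^ D) ^ (asssRec k t j).1 := Nat.pow_le_pow_right (by positivity) hr
    _ = (s + 1) ^ (D * (asssRec k t j).1) := (pow_mul _ _ _).symm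
    _ ≤ s ^ asssR (max k t) D := level_char_budget_of_le_sub_three hs hD hj

/-- The sparsity budgets are monotone too: `r! · s^r ≤ R! · s^R` for the block value
`r = r_{2+j} ≤ R = asssR (max k t) D` (`j ≤ D - 3`, `s ≥ 1`).
[cite: AgrawalEtAl2011, §4 (Thm. dDkrPIT, proof: "sparsity bounded by `s^R`"); ForbesShpilkaVolk2018, Thm. 48 (seq.) = ToC Thm. 5.24 (`R!·s^R`)]
locator: paper:arxiv-1111.0582 p0010.txt:L49–L55 -/
theorem sparsity_budget_of_le_sub_three {s k D t j : ℕ} (hs : 1 ≤ s) (hD : 1 ≤ D)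
    (hj : j ≤ D - 3) :
    ((asssRec k t j).1).factorial * s ^ (asssRec k t j).1 ≤
      (asssR (max k t) D).factorial * s ^ asssR (max k t) D :=
  Nat.mul_le_mul (Nat.factorial_le (asssRec_fst_le_asssR_max_of_le_sub_three hD hj))
    (Nat.pow_le_pow_right hs (asssRec_fst_le_asssR_max_of_le_sub_three hD hj))

end ASSS16

end Literature.Computability.AlgebraicComplexity
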